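import Mathlib
import HarnessLib
import HarnessLib.Audit
import Summits.Langlands.Statement
import Summits.Langlands.Langlands.Theses.ParahoricFibre
import Literature.NumberTheory.GaloisRepresentations.OrdinaryRegular
import Literature.NumberTheory.GaloisRepresentations.LocalClassFieldTheory
import Literature.NumberTheory.GaloisRepresentations.LocalArtinMapPinned
import Summits.Langlands.Langlands.Theses.OrdinaryLocusCarving

/-! # BC3 birth skeleton (pre-birth twin: carries verbatim copies of the cell and of the stub statements; `Iff.rfl` to the route decl once born) for
`OrdinaryLocusCarving.OrdinaryParahoricOccurrence` (rank 2).  NAMED stubs = the parent crux's REGISTERED skeleton `Cruxes/ParahoricOccurrence/Lines/birth.lean` re-homed to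
the cell: stub 1 (Iwahori occurrence, KNOWN), stub 2∣cell (the patching datum with the dial inserted — the cell's open content), stub 3 (Flath, KNOWN);
`OrdinaryParahoricOccurrence_of` is the parent's composition, kernel-checked (sorries ONLY inside `stub_*`). -/

/-! ## J3 stated against Matsumoto Def. 5.9 VERBATIM (critic row 283 c2) and the degenerate corner
Def. 5.9 [arXiv:2312.01551 p.69 L1–3]: «l is fully decomposed generic for r̄ if l splits completely in F, for all v ∣ l, r̄|G_Fv is unramified and the
eigenvalues α_{v,1}, …, α_{v,n} of r̄(Frob_v) satisfy α_{v,i}/α_{v,j} ≠ l for all i, j» — NO distinctness of the α's is asked; i = j forces l ≢ 1 (mod p).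
The cell's hypothesis «∃ l ≠ p prime, ∀ w ∣ l: q_w = l, ρ unramified, Frobenius roots a with ‖a_i − a_j‖ = 1 ∧ ‖a_i − l·a_j‖ = 1 for i ≠ j» is NOT this
(it asks residue degree one, not total splitting, and omits i = j): the junction J3 must PRODUCE a Def-5.9 prime from the big-image hypothesis
(SL_n(𝔽_p) ≤ image of the integral frame) and ζ_p ∉ K by Chebotarev — reduction and finite check = instrument I-L6g24.A of the memo; this is the
honest open part of `stub_ordinaryParahoricPatchingDatum` besides typing J2 in the cell's C-normalised currency (memo F-g24.2).
DEGENERATE CORNER n ≤ 1: p > n² allows p = 2 at n = 1 (ζ₂ ∈ K, so Matsumoto's (3) fails) and n = 0; these corners are closed by the rank-one /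
N = 0 case (W.N = 0 ⇒ 𝔭(W) = GL₁(𝒪_v); unipotent ⇒ trivial inertia ⇒ unramified character ⇒ spherical vector, class field theory; n = 0 trivial
group — rattack-18194 2026-08-17), NOT by Matsumoto; the J1–J4 chain is invoked only for n ≥ 2 (then p ≥ 5). -/

set_option linter.dupNamespace false
set_option linter.unusedVariables false

namespace Summit.Langlands.Langlands.Theses.OrdinaryLocusCarving.Birth.OrdinaryParahoricOccurrence

open scoped BigOperators Topology Manifold Classical MeasureTheory ProbabilityTheory Matrix InnerProductSpace ComplexConjugate ContinuousMap NumberField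
open Filter Set Function TopologicalSpace MeasureTheory

/-- verbatim copy of the cell `OrdinaryParahoricOccurrence` (texts.json; = the route decl by `Iff.rfl` after birth). -/
def OrdinaryParahoricOccurrence : Prop :=
  open IsDedekindDomain NumberField Polynomial Filter Literature.NumberTheory.Automorphic Literature.NumberTheory.GaloisRepresentations in ∀ (K : Type) [Field K] [NumberField K], NumberField.IsCMField K → ∀ (n : ℕ) (hcpt : isCompact_glFiniteIntegralLevel n K) (π : CuspidalAutomorphicRepData n K hcpt), π.1.IsRegularAlgebraic → ∀ (p : ℕ) [Fact p.Prime] (ι : PadicAlgCl p ≃+* ℂ) (ρ : FramedGaloisRep K (PadicAlgCl p) n), ρ.toGaloisRep.IsSemisimple → (∀ᶠ v : HeightOneSpectrum (𝓞 K) in cofinite, ∀ α : Multiset ℂ, π.1.HasSatakeParamAt v α → ρ.IsUnramifiedAt v ∧ ρ.HasFrobCharpolyAt v (arithFrobPolyOfSatake ι v.residueCard n α)) → n ^ 2 < p → ¬ ((p : ℤ) ∣ NumberField.discr K) → (∀ w : HeightOneSpectrum (𝓞 K), ((p : ℕ) : 𝓞 K) ∈ w.asIdeal → π.1.IsUnramifiedAt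 w) → (∀ w : HeightOneSpectrum (𝓞 K), ((p : ℕ) : 𝓞 K) ∈ w.asIdeal → ∀ art : LocalArtinData (w.adicCompletion K), art.IsCanonical → ρ.IsOrdinaryRegularAt w art) → ∀ g : GL (Fin n) (PadicAlgCl p), (∀ (σ : Field.absoluteGaloisGroup K) (i j : Fin n), ‖((g * ρ σ * g⁻¹ : GL (Fin n) (PadicAlgCl p)) : Matrix (Fin n) (Fin n) (PadicAlgCl p)) i j‖ ≤ 1) → (∀ M : Matrix (Fin n) (Fin n) ℤ, M.det = 1 → ∃ σ : Field.absoluteGaloisGroup K, ∀ i j : Fin n, ‖((g * ρ σ * g⁻¹ : GL (Fin n) (PadicAlgCl p)) : Matrix (Fin n) (Fin n) (PadicAlgCl p)) i j - ((M i j : ℤ) : PadicAlgCl p)‖ < 1) → (∃ l : ℕ, l.Prime ∧ l ≠ p ∧ ∀ w : HeightOneSpectrum (𝓞 K), ((l : ℕ) : 𝓞 K) ∈ w.asIdeal → w.residueCard = l ∧ ρ.IsUnramifiedAt w ∧ ∃ a : Fin n → PadicAlgCl p, ρ.HasFrobCharpolyAt w (∏ i, (X - C (a i))) ∧ ∀ i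 j : Fin n, i ≠ j → ‖a i - a j‖ = 1 ∧ ‖a i - (l : PadicAlgCl p) * a j‖ = 1) → ∀ v : HeightOneSpectrum (𝓞 K), ((p : ℕ) : 𝓞 K) ∉ v.asIdeal → p ∣ (v.residueCard - 1) → (∀ (σ : Field.absoluteGaloisGroup (v.adicCompletion K)) (i j : Fin n), ‖((g * ρ.toLocal v σ * g⁻¹ : GL (Fin n) (PadicAlgCl p)) : Matrix (Fin n) (Fin n) (PadicAlgCl p)) i j - (1 : Matrix (Fin n) (Fin n) (PadicAlgCl p)) i j‖ < 1) → (∀ σ ∈ absInertia (v.adicCompletion K), (((ρ.toLocal v σ : GL (Fin n) (PadicAlgCl p)) : Matrix (Fin n) (Fin n) (PadicAlgCl p)) - 1) ^ n = 0) → ∀ W : WeilDeligneRep (v.adicCompletion K) (PadicAlgCl p) (Fin n → PadicAlgCl p), IsWeilDeligneOfLadic (ρ.toLocal v).toWeilGroupHom W → ∃ πv : SmoothIrrep (GL (Fin n) (v.adicCompletion K)), π.1.HasLocalComponentAt v πv.ρ ∧ ∃ x : πv.V, x ≠ 0 ∧ ∀ g₁ : GL (Fin n) (v.adicCompletion K),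 (∀ i j : Fin n, Valued.v ((g₁ : Matrix (Fin n) (Fin n) (v.adicCompletion K)) i j) ≤ 1) → Valued.v (g₁ : Matrix (Fin n) (Fin n) (v.adicCompletion K)).det = 1 → (∀ i j : Fin n, (Finset.univ.filter fun t : Fin n => n ≤ j.val + Module.finrank (PadicAlgCl p) (LinearMap.range (W.N ^ (t.val + 1)))).card < (Finset.univ.filter fun t : Fin n => n ≤ i.val + Module.finrank (PadicAlgCl p) (LinearMap.range (W.N ^ (t.val + 1)))).card → Valued.v ((g₁ : Matrix (Fin n) (Fin n) (v.adicCompletion K)) i j) < 1) → πv.ρ g₁ x = x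

/-- stub 1 of the parent skeleton VERBATIM — KNOWN in print (Varma 2024 ss-compatibility + Borel 1976 + Flath): unipotent inertia at v ⇒ a global vector fixed modulo W′ by the Iwahori at v. -/
theorem stub_iwahoriOccurrence :
    open IsDedekindDomain NumberField Polynomial Filter Literature.NumberTheory.Automorphic Literature.NumberTheory.GaloisRepresentations Summit.Langlands in ∀ (K : Type) [Field K] [NumberField K], NumberField.IsCMField K → ∀ (n : ℕ) (hcpt : isCompact_glFiniteIntegralLevel n K) (π : CuspidalAutomorphicRepData n K hcpt), π.1.IsRegularAlgebraic → ∀ (p : ℕ) [Fact p.Prime] (ι : PadicAlgCl p ≃+* ℂ) (ρ : FramedGaloisRep K (PadicAlgCl p) n), ρ.toGaloisRep.IsSemisimple → (∀ᶠ v : HeightOneSpectrum (𝓞 K) in cofinite, ∀ α : Multiset ℂ, π.1.HasSatakeParamAt v α → ρ.IsUnramifiedAt v ∧ ρ.HasFrobCharpolyAt v (arithFrobPolyOfSatake ι v.residueCard n α)) → ∀ v : HeightOneSpectrum (𝓞 K), ((p : ℕ) : 𝓞 K) ∉ v.asIdeal → (∀ σ ∈ absInertia (v.adicCompletion K), (((ρ.toLocal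 v σ : GL (Fin n) (PadicAlgCl p)) : Matrix (Fin n) (Fin n) (PadicAlgCl p)) - 1) ^ n = 0) → ∃ φ ∈ π.1.W, φ ∉ π.1.W' ∧ ∀ g₁ : GL (Fin n) (v.adicCompletion K), (∀ i j : Fin n, Valued.v ((g₁ : Matrix (Fin n) (Fin n) (v.adicCompletion K)) i j) ≤ 1) → Valued.v (g₁ : Matrix (Fin n) (Fin n) (v.adicCompletion K)).det = 1 → (∀ i j : Fin n, j < i → Valued.v ((g₁ : Matrix (Fin n) (Fin n) (v.adicCompletion K)) i j) < 1) → rightTranslation (AdelicGroupData.gl n K) (GLn.ofLocal n K v g₁) φ - φ ∈ π.1.W' := by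
  sorry

/-- stub 2∣ORD — the parent's registered open stub `stub_parahoricPatchingDatum` (Cruxes/ParahoricOccurrence/Lines/birth.lean) with the dial ORD inserted after the Fontaine–Laffaille clause. ATTACKABLE / PRINT modulo typed junctions: J1 Galois-ordinary ⟺ ι-ordinary (A'Campo–Hevesi–Thorne–Whitmore arXiv:2607.11763 Thm 1.2.1 ∘ Matsumoto arXiv:2312.01551 Lemma 5.18) → J2 Matsumoto Thm 6.13 (F-ss local–global compatibility at all v ∤ p for ι-ordinary π, l > n²) → J3 Chebotarev (a FULLY decomposed generic prime from image ⊇ SL_n(𝔽_p), ζ_p ∉ K) → J4 Matsumoto Prop 2.20 (1)⇒(3) + Flath; then the trivial datum R = M = ℤ. -/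
theorem stub_ordinaryParahoricPatchingDatum :
    open IsDedekindDomain NumberField Polynomial Filter Literature.NumberTheory.Automorphic Literature.NumberTheory.GaloisRepresentations Summit.Langlands in ∀ (K : Type) [Field K] [NumberField K], NumberField.IsCMField K → ∀ (n : ℕ) (hcpt : isCompact_glFiniteIntegralLevel n K) (π : CuspidalAutomorphicRepData n K hcpt), π.1.IsRegularAlgebraic → ∀ (p : ℕ) [Fact p.Prime] (ι : PadicAlgCl p ≃+* ℂ) (ρ : FramedGaloisRep K (PadicAlgCl p) n), ρ.toGaloisRep.IsSemisimple → (∀ᶠ v : HeightOneSpectrum (𝓞 K) in cofinite, ∀ α : Multiset ℂ, π.1.HasSatakeParamAt v α → ρ.IsUnramifiedAt v ∧ ρ.HasFrobCharpolyAt v (arithFrobPolyOfSatake ι v.residueCard n α)) → n ^ 2 < p → ¬ ((p : ℤ) ∣ NumberField.discr K) → (∀ w : HeightOneSpectrum (𝓞 K), ((p : ℕ) : 𝓞 K) ∈ w.asIdeal → π.1.IsUnramifiedAt w) → (∀ w : HeightOneSpectrum (𝓞 K), ((p : ℕ) : 𝓞 K) ∈ w.asIdeal → ∀ art : LocalArtinData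 (w.adicCompletion K), art.IsCanonical → ρ.IsOrdinaryRegularAt w art) → ∀ g : GL (Fin n) (PadicAlgCl p), (∀ (σ : Field.absoluteGaloisGroup K) (i j : Fin n), ‖((g * ρ σ * g⁻¹ : GL (Fin n) (PadicAlgCl p)) : Matrix (Fin n) (Fin n) (PadicAlgCl p)) i j‖ ≤ 1) → (∀ M : Matrix (Fin n) (Fin n) ℤ, M.det = 1 → ∃ σ : Field.absoluteGaloisGroup K, ∀ i j : Fin n, ‖((g * ρ σ * g⁻¹ : GL (Fin n) (PadicAlgCl p)) : Matrix (Fin n) (Fin n) (PadicAlgCl p)) i j - ((M i j : ℤ) : PadicAlgCl p)‖ < 1) → (∃ l : ℕ, l.Prime ∧ l ≠ p ∧ ∀ w : HeightOneSpectrum (𝓞 K), ((l : ℕ) : 𝓞 K) ∈ w.asIdeal → w.residueCard = l ∧ ρ.IsUnramifiedAt w ∧ ∃ a : Fin n → PadicAlgCl p, ρ.HasFrobCharpolyAt w (∏ i, (X - C (a i))) ∧ ∀ i j : Fin n, i ≠ j → ‖a i - a j‖ = 1 ∧ ‖a i - (l : PadicAlgCl p) * a j‖ = 1) → ∀ v :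 HeightOneSpectrum (𝓞 K), ((p : ℕ) : 𝓞 K) ∉ v.asIdeal → p ∣ (v.residueCard - 1) → (∀ (σ : Field.absoluteGaloisGroup (v.adicCompletion K)) (i j : Fin n), ‖((g * ρ.toLocal v σ * g⁻¹ : GL (Fin n) (PadicAlgCl p)) : Matrix (Fin n) (Fin n) (PadicAlgCl p)) i j - (1 : Matrix (Fin n) (Fin n) (PadicAlgCl p)) i j‖ < 1) → (∀ σ ∈ absInertia (v.adicCompletion K), (((ρ.toLocal v σ : GL (Fin n) (PadicAlgCl p)) : Matrix (Fin n) (Fin n) (PadicAlgCl p)) - 1) ^ n = 0) → ∀ W : WeilDeligneRep (v.adicCompletion K) (PadicAlgCl p) (Fin n → PadicAlgCl p), IsWeilDeligneOfLadic (ρ.toLocal v).toWeilGroupHom W → (∃ φ ∈ π.1.W, φ ∉ π.1.W' ∧ ∀ g₁ : GL (Fin n) (v.adicCompletion K), (∀ i j : Fin n, Valued.v ((g₁ : Matrix (Fin n) (Fin n) (v.adicCompletion K)) i j) ≤ 1) → Valued.v (g₁ : Matrix (Fin n) (Fin n) (v.adicCompletion K)).det = 1 → (∀ i j : Fin n, j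 < i → Valued.v ((g₁ : Matrix (Fin n) (Fin n) (v.adicCompletion K)) i j) < 1) → rightTranslation (AdelicGroupData.gl n K) (GLn.ofLocal n K v g₁) φ - φ ∈ π.1.W') → ∃ (R : Type) (_ : CommRing R) (_ : IsNoetherianRing R) (M : Type) (_ : AddCommGroup M) (_ : Module R M) (_ : Module.Finite R M) (𝔮 𝔭x : Ideal R) (_ : 𝔮.IsPrime) (_ : 𝔭x.IsPrime), 𝔮 ≤ 𝔭x ∧ Nontrivial (LocalizedModule 𝔮.primeCompl M) ∧ (Nontrivial (LocalizedModule 𝔭x.primeCompl M) → ∃ φ ∈ π.1.W, φ ∉ π.1.W' ∧ ∀ g₁ : GL (Fin n) (v.adicCompletion K), (∀ i j : Fin n, Valued.v ((g₁ : Matrix (Fin n) (Fin n) (v.adicCompletion K)) i j) ≤ 1) → Valued.v (g₁ : Matrix (Fin n) (Fin n) (v.adicCompletion K)).det = 1 → (∀ i j : Fin n, (Finset.univ.filter fun t : Fin n => n ≤ j.val + Module.finrank (PadicAlgCl p) (LinearMap.range (W.N ^ (t.val + 1)))).card < (Finset.univ.filter fun t : Fin n => n ≤ i.val + Module.finrank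 (PadicAlgCl p) (LinearMap.range (W.N ^ (t.val + 1)))).card → Valued.v ((g₁ : Matrix (Fin n) (Fin n) (v.adicCompletion K)) i j) < 1) → rightTranslation (AdelicGroupData.gl n K) (GLn.ofLocal n K v g₁) φ - φ ∈ π.1.W') := by
  sorry

/-- stub 3 of the parent skeleton VERBATIM — KNOWN in print (Flath 1979): a global vector fixed mod W′ by ι_v(J) ⇒ a local component with a J-fixed vector. -/
theorem stub_localComponentOfParahoricFixed :
    open IsDedekindDomain NumberField Polynomial Filter Literature.NumberTheory.Automorphic Literature.NumberTheory.GaloisRepresentations Summit.Langlands in ∀ (K : Type) [Field K] [NumberField K] (n : ℕ) (hcpt : isCompact_glFiniteIntegralLevel n K) (π : CuspidalAutomorphicRepData n K hcpt) (v : HeightOneSpectrum (𝓞 K)) (b : Fin n → ℕ), (∃ φ ∈ π.1.W, φ ∉ π.1.W' ∧ ∀ g₁ : GL (Fin n) (v.adicCompletion K), (∀ i j : Fin n, Valued.v ((g₁ : Matrix (Fin n) (Fin n) (v.adicCompletion K)) i j) ≤ 1) → Valued.v (g₁ : Matrix (Fin n) (Fin n) (v.adicCompletion K)).det = 1 → (∀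 i j : Fin n, b j < b i → Valued.v ((g₁ : Matrix (Fin n) (Fin n) (v.adicCompletion K)) i j) < 1) → rightTranslation (AdelicGroupData.gl n K) (GLn.ofLocal n K v g₁) φ - φ ∈ π.1.W') → ∃ πv : SmoothIrrep (GL (Fin n) (v.adicCompletion K)), π.1.HasLocalComponentAt v πv.ρ ∧ ∃ x : πv.V, x ≠ 0 ∧ ∀ g₁ : GL (Fin n) (v.adicCompletion K), (∀ i j : Fin n, Valued.v ((g₁ : Matrix (Fin n) (Fin n) (v.adicCompletion K)) i j) ≤ 1) → Valued.v (g₁ : Matrix (Fin n) (Fin n) (v.adicCompletion K)).det = 1 → (∀ i j : Fin n, b j < b i → Valued.v ((g₁ : Matrix (Fin n) (Fin n) (v.adicCompletion K)) i j) < 1) → πv.ρ g₁ x = x := by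
  sorry

/-- Support is closed under specialisation (`Module.mem_support_mono`) — the parent skeleton's proved helper. [folklore] -/
theorem nontrivial_localizedModule_of_le {R : Type*} [CommRing R] {M : Type*} [AddCommGroup M]
    [Module R M] {𝔮 𝔭 : Ideal R} [𝔮.IsPrime] [𝔭.IsPrime] (hle : 𝔮 ≤ 𝔭)
    (h : Nontrivial (LocalizedModule 𝔮.primeCompl M)) :
    Nontrivial (LocalizedModule 𝔭.primeCompl M) := by
  have h𝔮 : (⟨𝔮, inferInstance⟩ : PrimeSpectrum R) ∈ Module.support R M := h
  have h𝔭 : (⟨𝔭, inferInstance⟩ : PrimeSpectrum R) ∈ Module.support R M :=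
    Module.mem_support_mono (show (⟨𝔮, inferInstance⟩ : PrimeSpectrum R) ≤ ⟨𝔭, inferInstance⟩ from hle) h𝔮
  exact h𝔭

/-- `OrdinaryParahoricOccurrence` from its three stubs (kernel-checked, no sorry): the parent's composition with the dial hypothesis `hd` threaded into stub 2∣cell. -/
theorem OrdinaryParahoricOccurrence_of
    (h₁ : open IsDedekindDomain NumberField Polynomial Filter Literature.NumberTheory.Automorphic Literature.NumberTheory.GaloisRepresentations Summit.Langlands in ∀ (K : Type) [Field K] [NumberField K], NumberField.IsCMField K → ∀ (n : ℕ) (hcpt : isCompact_glFiniteIntegralLevel n K) (π : CuspidalAutomorphicRepData n K hcpt), π.1.IsRegularAlgebraic → ∀ (p : ℕ) [Fact p.Prime] (ι : PadicAlgCl p ≃+* ℂ) (ρ : FramedGaloisRep K (PadicAlgCl p) n), ρ.toGaloisRep.IsSemisimple → (∀ᶠ v : HeightOneSpectrum (𝓞 K) in cofinite, ∀ α : Multiset ℂ, π.1.HasSatakeParamAt v α → ρ.IsUnramifiedAt v ∧ ρ.HasFrobCharpolyAt v (arithFrobPolyOfSatake ι v.residueCard n α)) → ∀ v : HeightOneSpectrum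 (𝓞 K), ((p : ℕ) : 𝓞 K) ∉ v.asIdeal → (∀ σ ∈ absInertia (v.adicCompletion K), (((ρ.toLocal v σ : GL (Fin n) (PadicAlgCl p)) : Matrix (Fin n) (Fin n) (PadicAlgCl p)) - 1) ^ n = 0) → ∃ φ ∈ π.1.W, φ ∉ π.1.W' ∧ ∀ g₁ : GL (Fin n) (v.adicCompletion K), (∀ i j : Fin n, Valued.v ((g₁ : Matrix (Fin n) (Fin n) (v.adicCompletion K)) i j) ≤ 1) → Valued.v (g₁ : Matrix (Fin n) (Fin n) (v.adicCompletion K)).det = 1 → (∀ i j : Fin n, j < i → Valued.v ((g₁ : Matrix (Fin n) (Fin n) (v.adicCompletion K)) i j) < 1) → rightTranslation (AdelicGroupData.gl n K) (GLn.ofLocal n K v g₁) φ - φ ∈ π.1.W')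
    (h₂ : open IsDedekindDomain NumberField Polynomial Filter Literature.NumberTheory.Automorphic Literature.NumberTheory.GaloisRepresentations Summit.Langlands in ∀ (K : Type) [Field K] [NumberField K], NumberField.IsCMField K → ∀ (n : ℕ) (hcpt : isCompact_glFiniteIntegralLevel n K) (π : CuspidalAutomorphicRepData n K hcpt), π.1.IsRegularAlgebraic → ∀ (p : ℕ) [Fact p.Prime] (ι : PadicAlgCl p ≃+* ℂ) (ρ : FramedGaloisRep K (PadicAlgCl p) n), ρ.toGaloisRep.IsSemisimple → (∀ᶠ v : HeightOneSpectrum (𝓞 K) in cofinite, ∀ α : Multiset ℂ, π.1.HasSatakeParamAt v α → ρ.IsUnramifiedAt v ∧ ρ.HasFrobCharpolyAt v (arithFrobPolyOfSatake ι v.residueCard n α)) → n ^ 2 < p → ¬ ((p : ℤ) ∣ NumberField.discr K) → (∀ w : HeightOneSpectrum (𝓞 K), ((p : ℕ) : 𝓞 K) ∈ w.asIdeal → π.1.IsUnramifiedAt w) → (∀ w : HeightOneSpectrum (𝓞 K), ((p : ℕ) : 𝓞 K) ∈ w.asIdeal → ∀ art : LocalArtinData (w.adicCompletion K), art.IsCanonical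 → ρ.IsOrdinaryRegularAt w art) → ∀ g : GL (Fin n) (PadicAlgCl p), (∀ (σ : Field.absoluteGaloisGroup K) (i j : Fin n), ‖((g * ρ σ * g⁻¹ : GL (Fin n) (PadicAlgCl p)) : Matrix (Fin n) (Fin n) (PadicAlgCl p)) i j‖ ≤ 1) → (∀ M : Matrix (Fin n) (Fin n) ℤ, M.det = 1 → ∃ σ : Field.absoluteGaloisGroup K, ∀ i j : Fin n, ‖((g * ρ σ * g⁻¹ : GL (Fin n) (PadicAlgCl p)) : Matrix (Fin n) (Fin n) (PadicAlgCl p)) i j - ((M i j : ℤ) : PadicAlgCl p)‖ < 1) → (∃ l : ℕ, l.Prime ∧ l ≠ p ∧ ∀ w : HeightOneSpectrum (𝓞 K), ((l : ℕ) : 𝓞 K) ∈ w.asIdeal → w.residueCard = l ∧ ρ.IsUnramifiedAt w ∧ ∃ a : Fin n → PadicAlgCl p, ρ.HasFrobCharpolyAt w (∏ i, (X - C (a i))) ∧ ∀ i j : Fin n, i ≠ j → ‖a i - a j‖ = 1 ∧ ‖a i - (l : PadicAlgCl p) * a j‖ = 1) → ∀ v : HeightOneSpectrum (𝓞 K), ((p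 : ℕ) : 𝓞 K) ∉ v.asIdeal → p ∣ (v.residueCard - 1) → (∀ (σ : Field.absoluteGaloisGroup (v.adicCompletion K)) (i j : Fin n), ‖((g * ρ.toLocal v σ * g⁻¹ : GL (Fin n) (PadicAlgCl p)) : Matrix (Fin n) (Fin n) (PadicAlgCl p)) i j - (1 : Matrix (Fin n) (Fin n) (PadicAlgCl p)) i j‖ < 1) → (∀ σ ∈ absInertia (v.adicCompletion K), (((ρ.toLocal v σ : GL (Fin n) (PadicAlgCl p)) : Matrix (Fin n) (Fin n) (PadicAlgCl p)) - 1) ^ n = 0) → ∀ W : WeilDeligneRep (v.adicCompletion K) (PadicAlgCl p) (Fin n → PadicAlgCl p), IsWeilDeligneOfLadic (ρ.toLocal v).toWeilGroupHom W → (∃ φ ∈ π.1.W, φ ∉ π.1.W' ∧ ∀ g₁ : GL (Fin n) (v.adicCompletion K), (∀ i j : Fin n, Valued.v ((g₁ : Matrix (Fin n) (Fin n) (v.adicCompletion K)) i j) ≤ 1) → Valued.v (g₁ : Matrix (Fin n) (Fin n) (v.adicCompletion K)).det = 1 → (∀ i j : Fin n, j < i → Valued.v ((g₁ : Matrix (Fin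 n) (Fin n) (v.adicCompletion K)) i j) < 1) → rightTranslation (AdelicGroupData.gl n K) (GLn.ofLocal n K v g₁) φ - φ ∈ π.1.W') → ∃ (R : Type) (_ : CommRing R) (_ : IsNoetherianRing R) (M : Type) (_ : AddCommGroup M) (_ : Module R M) (_ : Module.Finite R M) (𝔮 𝔭x : Ideal R) (_ : 𝔮.IsPrime) (_ : 𝔭x.IsPrime), 𝔮 ≤ 𝔭x ∧ Nontrivial (LocalizedModule 𝔮.primeCompl M) ∧ (Nontrivial (LocalizedModule 𝔭x.primeCompl M) → ∃ φ ∈ π.1.W, φ ∉ π.1.W' ∧ ∀ g₁ : GL (Fin n) (v.adicCompletion K), (∀ i j : Fin n, Valued.v ((g₁ : Matrix (Fin n) (Fin n) (v.adicCompletion K)) i j) ≤ 1) → Valued.v (g₁ : Matrix (Fin n) (Fin n) (v.adicCompletion K)).det = 1 → (∀ i j : Fin n, (Finset.univ.filter fun t : Fin n => n ≤ j.val + Module.finrank (PadicAlgCl p) (LinearMap.range (W.N ^ (t.val + 1)))).card < (Finset.univ.filter fun t : Fin n => n ≤ i.val + Module.finrank (PadicAlgCl p) (LinearMap.range (W.N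 ^ (t.val + 1)))).card → Valued.v ((g₁ : Matrix (Fin n) (Fin n) (v.adicCompletion K)) i j) < 1) → rightTranslation (AdelicGroupData.gl n K) (GLn.ofLocal n K v g₁) φ - φ ∈ π.1.W'))
    (h₃ : open IsDedekindDomain NumberField Polynomial Filter Literature.NumberTheory.Automorphic Literature.NumberTheory.GaloisRepresentations Summit.Langlands in ∀ (K : Type) [Field K] [NumberField K] (n : ℕ) (hcpt : isCompact_glFiniteIntegralLevel n K) (π : CuspidalAutomorphicRepData n K hcpt) (v : HeightOneSpectrum (𝓞 K)) (b : Fin n → ℕ), (∃ φ ∈ π.1.W, φ ∉ π.1.W' ∧ ∀ g₁ : GL (Fin n) (v.adicCompletion K), (∀ i j : Fin n, Valued.v ((g₁ : Matrix (Fin n) (Fin n) (v.adicCompletion K)) i j) ≤ 1) → Valued.v (g₁ : Matrix (Fin n) (Fin n) (v.adicCompletion K)).det = 1 → (∀ i j : Fin n, b j < b i → Valued.v ((g₁ : Matrix (Fin n) (Fin n) (v.adicCompletion K)) i j) < 1) → rightTranslation (AdelicGroupData.gl n K) (GLn.ofLocal n K v g₁) φ - φ ∈ π.1.W') → ∃ πv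 : SmoothIrrep (GL (Fin n) (v.adicCompletion K)), π.1.HasLocalComponentAt v πv.ρ ∧ ∃ x : πv.V, x ≠ 0 ∧ ∀ g₁ : GL (Fin n) (v.adicCompletion K), (∀ i j : Fin n, Valued.v ((g₁ : Matrix (Fin n) (Fin n) (v.adicCompletion K)) i j) ≤ 1) → Valued.v (g₁ : Matrix (Fin n) (Fin n) (v.adicCompletion K)).det = 1 → (∀ i j : Fin n, b j < b i → Valued.v ((g₁ : Matrix (Fin n) (Fin n) (v.adicCompletion K)) i j) < 1) → πv.ρ g₁ x = x) :
    OrdinaryParahoricOccurrence := by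
  intro K _ _ hK n hcpt π hreg p _ ι ρ hss hsat hp hdisc hunr hd g hint hbig hl v hv hq htriv hunip W hW
  have hIw := h₁ K hK n hcpt π hreg p ι ρ hss hsat v hv hunip
  obtain ⟨R, _, _, M, _, _, _, 𝔮, 𝔭x, _, _, hle, hgen, hfib⟩ :=
    h₂ K hK n hcpt π hreg p ι ρ hss hsat hp hdisc hunr hd g hint hbig hl v hv hq htriv hunip W hW hIw
  have hx : Nontrivial (LocalizedModule 𝔭x.primeCompl M) := nontrivial_localizedModule_of_le hle hgen
  exact h₃ K n hcpt π v _ (hfib hx)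

/-- The skeleton concludes the cell BY NAME from the registered stubs. -/
theorem OrdinaryParahoricOccurrence_of_stubs : OrdinaryParahoricOccurrence := OrdinaryParahoricOccurrence_of stub_iwahoriOccurrence stub_ordinaryParahoricPatchingDatum stub_localComponentOfParahoricFixed

/-! ### BC5 rungs of the deciding cell ORD (PLAN-ONLY named stubs; NOT consumed by `OrdinaryParahoricOccurrence_of`)
* rung A `stub_rung_ordinaryOccurrenceRankTwo` — ORD ∣ `n = 2` (`rungA_of_cell`): GL₂ over a CM field at an ORDINARY `p` — PRINT as a method by the same
  junction chain (Matsumoto Thm 6.13 has no restriction on `n`; for `n = 2` also Yang / Allen–Newton-type ordinary arguments), in the regime (CM field, fixed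
  `p`) where the target (all `π`, fixed `p`) is NOT known: the non-ordinary weight-`>0` case of `n = 2` is open at a fixed `p` (Matsumoto Thm 1.5 (1) decides only a
  positive-density set of `l`).
* rung B `stub_rung_ordinaryOccurrenceRegularMonodromy` — ORD ∣ «`N` has one Jordan block» (`rk N^(n-1) = 1`, `rungB_of_cell`): then `𝔭(W)` is the Iwahori and
  the claim is Iwahori occurrence; DECIDED by stub 1's inputs (Varma `N_ρ ≺ N_π` forces `N_π` regular ⇒ `π_v` a Steinberg twist ⇒ Iwahori vector: Borel) — a
  KNOWN rung exercising the parahoric dictionary but NOT the ordinary lever (recorded as the honest floor of the ladder; it sits inside the target's known regime).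
-/

/-- BC5 rung A text: ORD ∣ n = 2. -/
def OrdinaryOccurrenceRankTwoRung : Prop :=
  open IsDedekindDomain NumberField Polynomial Filter Literature.NumberTheory.Automorphic Literature.NumberTheory.GaloisRepresentations in ∀ (K : Type) [Field K] [NumberField K], NumberField.IsCMField K → ∀ (n : ℕ) (hcpt : isCompact_glFiniteIntegralLevel n K) (π : CuspidalAutomorphicRepData n K hcpt), π.1.IsRegularAlgebraic → ∀ (p : ℕ) [Fact p.Prime] (ι : PadicAlgCl p ≃+* ℂ) (ρ : FramedGaloisRep K (PadicAlgCl p) n), ρ.toGaloisRep.IsSemisimple → (∀ᶠ v : HeightOneSpectrum (𝓞 K) in cofinite, ∀ α : Multiset ℂ, π.1.HasSatakeParamAt v α → ρ.IsUnramifiedAt v ∧ ρ.HasFrobCharpolyAt v (arithFrobPolyOfSatake ι v.residueCard n α)) → n ^ 2 < p → ¬ ((p : ℤ) ∣ NumberField.discr K) → (∀ w : HeightOneSpectrum (𝓞 K), ((p : ℕ) : 𝓞 K) ∈ w.asIdeal → π.1.IsUnramifiedAt w) → (∀ w : HeightOneSpectrum (𝓞 K), ((p : ℕ) : 𝓞 K)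 ∈ w.asIdeal → ∀ art : LocalArtinData (w.adicCompletion K), art.IsCanonical → ρ.IsOrdinaryRegularAt w art) → n = 2 → ∀ g : GL (Fin n) (PadicAlgCl p), (∀ (σ : Field.absoluteGaloisGroup K) (i j : Fin n), ‖((g * ρ σ * g⁻¹ : GL (Fin n) (PadicAlgCl p)) : Matrix (Fin n) (Fin n) (PadicAlgCl p)) i j‖ ≤ 1) → (∀ M : Matrix (Fin n) (Fin n) ℤ, M.det = 1 → ∃ σ : Field.absoluteGaloisGroup K, ∀ i j : Fin n, ‖((g * ρ σ * g⁻¹ : GL (Fin n) (PadicAlgCl p)) : Matrix (Fin n) (Fin n) (PadicAlgCl p)) i j - ((M i j : ℤ) : PadicAlgCl p)‖ < 1) → (∃ l : ℕ, l.Prime ∧ l ≠ p ∧ ∀ w : HeightOneSpectrum (𝓞 K), ((l : ℕ) : 𝓞 K) ∈ w.asIdeal → w.residueCard = l ∧ ρ.IsUnramifiedAt w ∧ ∃ a : Fin n → PadicAlgCl p, ρ.HasFrobCharpolyAt w (∏ i, (X - C (a i))) ∧ ∀ i j : Fin n, i ≠ j → ‖a i - a j‖ = 1 ∧ ‖a i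 - (l : PadicAlgCl p) * a j‖ = 1) → ∀ v : HeightOneSpectrum (𝓞 K), ((p : ℕ) : 𝓞 K) ∉ v.asIdeal → p ∣ (v.residueCard - 1) → (∀ (σ : Field.absoluteGaloisGroup (v.adicCompletion K)) (i j : Fin n), ‖((g * ρ.toLocal v σ * g⁻¹ : GL (Fin n) (PadicAlgCl p)) : Matrix (Fin n) (Fin n) (PadicAlgCl p)) i j - (1 : Matrix (Fin n) (Fin n) (PadicAlgCl p)) i j‖ < 1) → (∀ σ ∈ absInertia (v.adicCompletion K), (((ρ.toLocal v σ : GL (Fin n) (PadicAlgCl p)) : Matrix (Fin n) (Fin n) (PadicAlgCl p)) - 1) ^ n = 0) → ∀ W : WeilDeligneRep (v.adicCompletion K) (PadicAlgCl p) (Fin n → PadicAlgCl p), IsWeilDeligneOfLadic (ρ.toLocal v).toWeilGroupHom W → ∃ πv : SmoothIrrep (GL (Fin n) (v.adicCompletion K)), π.1.HasLocalComponentAt v πv.ρ ∧ ∃ x : πv.V, x ≠ 0 ∧ ∀ g₁ : GL (Fin n) (v.adicCompletion K), (∀ i j : Fin n, Valued.v ((g₁ : Matrix (Fin n) (Fin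 n) (v.adicCompletion K)) i j) ≤ 1) → Valued.v (g₁ : Matrix (Fin n) (Fin n) (v.adicCompletion K)).det = 1 → (∀ i j : Fin n, (Finset.univ.filter fun t : Fin n => n ≤ j.val + Module.finrank (PadicAlgCl p) (LinearMap.range (W.N ^ (t.val + 1)))).card < (Finset.univ.filter fun t : Fin n => n ≤ i.val + Module.finrank (PadicAlgCl p) (LinearMap.range (W.N ^ (t.val + 1)))).card → Valued.v ((g₁ : Matrix (Fin n) (Fin n) (v.adicCompletion K)) i j) < 1) → πv.ρ g₁ x = x

/-- BC5 rung B text: ORD ∣ N regular (one Jordan block). -/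
def OrdinaryOccurrenceRegularMonodromyRung : Prop :=
  open IsDedekindDomain NumberField Polynomial Filter Literature.NumberTheory.Automorphic Literature.NumberTheory.GaloisRepresentations in ∀ (K : Type) [Field K] [NumberField K], NumberField.IsCMField K → ∀ (n : ℕ) (hcpt : isCompact_glFiniteIntegralLevel n K) (π : CuspidalAutomorphicRepData n K hcpt), π.1.IsRegularAlgebraic → ∀ (p : ℕ) [Fact p.Prime] (ι : PadicAlgCl p ≃+* ℂ) (ρ : FramedGaloisRep K (PadicAlgCl p) n), ρ.toGaloisRep.IsSemisimple → (∀ᶠ v : HeightOneSpectrum (𝓞 K) in cofinite, ∀ α : Multiset ℂ, π.1.HasSatakeParamAt v α → ρ.IsUnramifiedAt v ∧ ρ.HasFrobCharpolyAt v (arithFrobPolyOfSatake ι v.residueCard n α)) → n ^ 2 < p → ¬ ((p : ℤ) ∣ NumberField.discr K) → (∀ w : HeightOneSpectrum (𝓞 K), ((p : ℕ) : 𝓞 K) ∈ w.asIdeal → π.1.IsUnramifiedAt w) → (∀ w : HeightOneSpectrum (𝓞 K), ((p : ℕ) : 𝓞 K) ∈ w.asIdeal → ∀ art : LocalArtinData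 (w.adicCompletion K), art.IsCanonical → ρ.IsOrdinaryRegularAt w art) → ∀ g : GL (Fin n) (PadicAlgCl p), (∀ (σ : Field.absoluteGaloisGroup K) (i j : Fin n), ‖((g * ρ σ * g⁻¹ : GL (Fin n) (PadicAlgCl p)) : Matrix (Fin n) (Fin n) (PadicAlgCl p)) i j‖ ≤ 1) → (∀ M : Matrix (Fin n) (Fin n) ℤ, M.det = 1 → ∃ σ : Field.absoluteGaloisGroup K, ∀ i j : Fin n, ‖((g * ρ σ * g⁻¹ : GL (Fin n) (PadicAlgCl p)) : Matrix (Fin n) (Fin n) (PadicAlgCl p)) i j - ((M i j : ℤ) : PadicAlgCl p)‖ < 1) → (∃ l : ℕ, l.Prime ∧ l ≠ p ∧ ∀ w : HeightOneSpectrum (𝓞 K), ((l : ℕ) : 𝓞 K) ∈ w.asIdeal → w.residueCard = l ∧ ρ.IsUnramifiedAt w ∧ ∃ a : Fin n → PadicAlgCl p, ρ.HasFrobCharpolyAt w (∏ i, (X - C (a i))) ∧ ∀ i j : Fin n, i ≠ j → ‖a i - a j‖ = 1 ∧ ‖a i - (l : PadicAlgCl p) * a j‖ = 1) → ∀ v :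 HeightOneSpectrum (𝓞 K), ((p : ℕ) : 𝓞 K) ∉ v.asIdeal → p ∣ (v.residueCard - 1) → (∀ (σ : Field.absoluteGaloisGroup (v.adicCompletion K)) (i j : Fin n), ‖((g * ρ.toLocal v σ * g⁻¹ : GL (Fin n) (PadicAlgCl p)) : Matrix (Fin n) (Fin n) (PadicAlgCl p)) i j - (1 : Matrix (Fin n) (Fin n) (PadicAlgCl p)) i j‖ < 1) → (∀ σ ∈ absInertia (v.adicCompletion K), (((ρ.toLocal v σ : GL (Fin n) (PadicAlgCl p)) : Matrix (Fin n) (Fin n) (PadicAlgCl p)) - 1) ^ n = 0) → ∀ W : WeilDeligneRep (v.adicCompletion K) (PadicAlgCl p) (Fin n → PadicAlgCl p), IsWeilDeligneOfLadic (ρ.toLocal v).toWeilGroupHom W → Module.finrank (PadicAlgCl p) (LinearMap.range (W.N ^ (n - 1))) = 1 → ∃ πv : SmoothIrrep (GL (Fin n) (v.adicCompletion K)), π.1.HasLocalComponentAt v πv.ρ ∧ ∃ x : πv.V, x ≠ 0 ∧ ∀ g₁ : GL (Fin n) (v.adicCompletion K), (∀ i j : Fin n, Valued.v ((g₁ : Matrix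 (Fin n) (Fin n) (v.adicCompletion K)) i j) ≤ 1) → Valued.v (g₁ : Matrix (Fin n) (Fin n) (v.adicCompletion K)).det = 1 → (∀ i j : Fin n, (Finset.univ.filter fun t : Fin n => n ≤ j.val + Module.finrank (PadicAlgCl p) (LinearMap.range (W.N ^ (t.val + 1)))).card < (Finset.univ.filter fun t : Fin n => n ≤ i.val + Module.finrank (PadicAlgCl p) (LinearMap.range (W.N ^ (t.val + 1)))).card → Valued.v ((g₁ : Matrix (Fin n) (Fin n) (v.adicCompletion K)) i j) < 1) → πv.ρ g₁ x = x

/-- **BC5 rung A (plan-only)** — ORD ∣ n = 2; first prover target of the cell (technique: J1–J4 with n = 2, or Yang 2021 / Allen–Newton ordinary case). -/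
theorem stub_rung_ordinaryOccurrenceRankTwo : OrdinaryOccurrenceRankTwoRung := by
  sorry

/-- **BC5 rung B (plan-only, KNOWN floor)** — ORD ∣ N regular: Iwahori occurrence (Varma + Borel + Flath). -/
theorem stub_rung_ordinaryOccurrenceRegularMonodromy : OrdinaryOccurrenceRegularMonodromyRung := by
  sorry

/-- rung A IS the `n = 2` restriction of the cell. -/
theorem rungA_of_cell (h : OrdinaryParahoricOccurrence) : OrdinaryOccurrenceRankTwoRung :=
  fun K _ _ hK n hcpt π hπ p _ ι ρ hss hsat hp hdisc hunr hd _ => h K hK n hcpt π hπ p ι ρ hss hsat hp hdisc hunr hd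

/-- rung B IS the regular-monodromy restriction of the cell. -/
theorem rungB_of_cell (h : OrdinaryParahoricOccurrence) : OrdinaryOccurrenceRegularMonodromyRung :=
  fun K _ _ hK n hcpt π hπ p _ ι ρ hss hsat hp hdisc hunr hd g hint hbig hl v hv hq htriv hunip W hW _ =>
    h K hK n hcpt π hπ p ι ρ hss hsat hp hdisc hunr hd g hint hbig hl v hv hq htriv hunip W hW


/-- identity with the born route decl (elaborates only AFTER birth). -/
theorem OrdinaryParahoricOccurrence_iff_route : OrdinaryParahoricOccurrence ↔ Summit.Langlands.Langlands.Theses.OrdinaryLocusCarving.OrdinaryParahoricOccurrence := Iff.rfl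

/-- the ROUTE decl from the stubs. -/
theorem route_OrdinaryParahoricOccurrence_of_stubs : Summit.Langlands.Langlands.Theses.OrdinaryLocusCarving.OrdinaryParahoricOccurrence := OrdinaryParahoricOccurrence_iff_route.1 OrdinaryParahoricOccurrence_of_stubs

end Summit.Langlands.Langlands.Theses.OrdinaryLocusCarving.Birth.OrdinaryParahoricOccurrence
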